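import Mathlib
import HarnessLib
import Literature.Analysis.FluidPDE.ClassicalSolution
import Literature.Analysis.FluidPDE.LerayHopf
import Literature.Analysis.FluidPDE.SuitableWeak
import Literature.Analysis.FluidPDE.TaoLocalisationHolds
import Literature.Analysis.FluidPDE.TaoFiniteEnergyLerayHopf
import Summits.NavierStokesRegularity.NavierStokesRegularity.Theorems.QuarterJoltSliceTestIncrementH1
import Summits.NavierStokesRegularity.NavierStokesRegularity.Theorems.CertifiedBlowupCertifiedBlowupAxisymBlowupEnergyDrain
import Summits.NavierStokesRegularity.NavierStokesRegularity.Theorems.QuarterJoltTypeIEnergyEquality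
import Summits.NavierStokesRegularity.NavierStokesRegularity.Theorems.HodographBetchovFastClassSqueezeNoConcentration

/-!
# Route QuarterJolt — crux `NoTerminalJolt` (stmt-NavierStokesRegularity-26463), LEAD line
# `regular_split` rev 5: A FIRST BLOW-UP WITH ENSTROPHY BELOW `(T−t)^{−4/5}` HAS NO ENERGY JUMP

Seat ns-ntj-p1 g4 (LEAD of the crux; `--supports 26463 --as helper`). Last file of the ENSTROPHY-RATE
ENERGY EQUALITY chain. Frame: `(u,p)` classical on `[0,T)` (`ν, T > 0`), Leray–Hopf on `[0,T]` from a
rapidly decaying datum.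

THE THEOREM (`tendsto_integral_norm_sub_sq_of_enstrophyRate`): if `∫|Du(t)|²_F ≤ M (T−t)^{−α}` for
`t < T` near `T` with `0 < α < 4/5`, then `∫‖u(t) − u(T)‖² → 0` as `t ↑ T` — equivalently LERAY'S
ENERGY EQUALITY on `[0,T]` (`energyEquality_of_enstrophyRate`). Leray's lower rate is `α = 1/2`; the
ENSTROPHY QUARTER LAW of this route (stmt-1574) asserts `α = 1/2` uniformly; so the energy equality at
a first blow-up can fail only if the enstrophy exceeds `(T−t)^{−4/5+ε}` along a sequence of times
(«Type II in enstrophy by at least 3/10 beyond Leray») AND the blow-up is not sup-norm Type I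
(`tendsto_integral_norm_sub_sq_of_isTypeIBlowup`, p639359). In print the class is inside
`L³B^{1/3}_{3,∞}` (Cheskidov–Constantin–Friedlander–Shvydkoy 2008; Cheskidov–Luo, Nonlinearity 33
(2020) §2.2, interpolation `‖u‖_{B^{1/3}_{3,∞}} ≲ ‖u‖₂^{1/6}‖∇u‖₂^{5/6}`); HERE by elementary slice
testing:

1. `enstrophyRate_terminalApproach_le` — `∫‖u(t) − u(T)‖² ≤ (ν/2)(T−t)Z(t) +
   2K^{3/2}(2E₀)^{1/4}M^{3/4}√Z(t)(T−t)^{1−3α/4}/(1−3α/4)` (`‖a−b‖² = 2⟨a−b,a⟩ − (‖a‖²−‖b‖²)`;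
   `sliceTestH1_terminal_abs_le` with `η = 2`; the energy drop absorbs the dissipation).
2. With `Z(t) ≤ M(T−t)^{−α}`: `∫‖u(t) − u(T)‖² ≤ C₁(T−t)^{1−α} + C₂(T−t)^{1−5α/4} → 0`.

BY-PRODUCTS: `eLpNorm` / energy-equality forms; `noFastEnergyConcentration_of_enstrophyRate` (the
conclusion of shelf statement stmt-18118 for such solutions); POSITION for the skeleton:
`typeIIEnergyEquality_iff_enstrophyHeavy` — stub `stub_typeIIEnergyEquality` of
`Cruxes/NoTerminalJolt/Lines/regular_split.lean` ⟺ the same statement restricted to first blow-ups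
that are NOT sup-norm Type I AND ENSTROPHY-HEAVY (no rate `M(T−t)^{−α}`, `α < 4/5`, near `T`).
HONEST FRAMING: nothing here claims progress on `NoTerminalJolt`, the energy equality at a genuine
Type-II blow-up, or Navier–Stokes regularity — all OPEN. No summit statement is proved here. [folklore]
-/

noncomputable section

-- the summit and its single sub-problem share the name (CONVENTIONS §1), as in every Theorems file
set_option linter.dupNamespace false

namespace Summit.NavierStokesRegularity.NavierStokesRegularity.Theorems

open MeasureTheory Set Function Filter Topology InnerProductSpace
open scoped ENNReal NNReal ContDiff RealInnerProductSpace
open Literature.Analysis.FluidPDE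

namespace NoTerminalJolt

/-! ### In the frame: the slice-test increment up to `T` under an enstrophy rate -/

/-- **The slice-test increment up to the terminal time under an ENSTROPHY RATE** (frame; `t ∈ (0,T)`;
`∫|Du(τ)|²_F ≤ M (T−τ)^{−α}` on `(t,T)`, `M ≥ 0`, `0 < α < 4/3`; `η > 0`; `Z = ∫|Du(t)|²_F`,
`E₀ = E(u 0)`): `|∫⟪u(T),u(t)⟫ − ∫‖u(t)‖²| ≤ (ν/2)η(∫⁻_{(t,T)}∫⁻|Du|²_F).toReal + (ν/2)η⁻¹Z(T−t)
  + K^{3/2}(2E₀)^{1/4}√Z M^{3/4}(T−t)^{1−3α/4}/(1−3α/4)`. [folklore] -/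
theorem sliceTestH1_terminal_abs_le {ν T : ℝ} (hν : 0 < ν) (hT : 0 < T)
    {u : ℝ → EuclideanSpace ℝ (Fin 3) → EuclideanSpace ℝ (Fin 3)} {p : ℝ → EuclideanSpace ℝ (Fin 3) → ℝ}
    (hcl : IsClassicalNSSolutionOn (Ico 0 T) ν 0 u p) (hLH : IsLerayHopfOn T ν 0 (u 0) u)
    (hdec : HasRapidSpatialDecay (u 0))
    {M α : ℝ} (hM : 0 ≤ M) (hα0 : 0 < α) (hα : α < 4 / 3) {t : ℝ} (ht : t ∈ Ioo 0 T)
    (hZ : ∀ τ ∈ Ioo t T, ∫ x, frobeniusNormSq (fderiv ℝ (u τ) x) ≤ M * (T - τ) ^ (-α))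
    {η : ℝ} (hη : 0 < η) :
    |(∫ x, ⟪u T x, u t x⟫) - ∫ x, ‖u t x‖ ^ 2| ≤
      ν / 2 * η *
          (∫⁻ τ in Ioo t T, ∫⁻ x, ENNReal.ofReal (frobeniusNormSq (fderiv ℝ (u τ) x))).toReal +
        ν / 2 * η⁻¹ * (∫ x, frobeniusNormSq (fderiv ℝ (u t) x)) * (T - t) +
        (SNormLESNormFDerivOfEqConst (EuclideanSpace ℝ (Fin 3))
            (volume : Measure (EuclideanSpace ℝ (Fin 3))) 2 : ℝ) ^ (3 / 2 : ℝ) *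
          (2 * VectorCalculus.kineticEnergy (u 0)) ^ (1 / 4 : ℝ) *
          Real.sqrt (∫ x, frobeniusNormSq (fderiv ℝ (u t) x)) *
          M ^ (3 / 4 : ℝ) * ((T - t) ^ (1 - 3 * α / 4) / (1 - 3 * α / 4)) := by
  set Kc : ℝ := (SNormLESNormFDerivOfEqConst (EuclideanSpace ℝ (Fin 3))
    (volume : Measure (EuclideanSpace ℝ (Fin 3))) 2 : ℝ) with hKc
  have hmt : MemLp (u t) 2 volume := hLH.memLp t ⟨ht.1.le, ht.2.le⟩
  set I₀ : ℝ := 2 * VectorCalculus.kineticEnergy (u 0) with hI₀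
  have hI₀le : ∀ τ ∈ Icc 0 T, ∫ x, ‖u τ x‖ ^ 2 ≤ I₀ := by
    intro τ hτ
    have h := CertifiedBlowupAxisymBlowup.EnergyDrain.kineticEnergy_antitoneOn hν hcl hLH
      ⟨le_rfl, hT.le⟩ hτ hτ.1
    have h2 : ∫ x, ‖u τ x‖ ^ 2 = 2 * VectorCalculus.kineticEnergy (u τ) := by
      simp only [VectorCalculus.kineticEnergy]; ring
    rw [h2, hI₀]
    simp only at h
    linarith
  set Z : ℝ := ∫ x, frobeniusNormSq (fderiv ℝ (u t) x) with hZdef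
  have hZ0 : 0 ≤ Z := integral_nonneg fun x => frobeniusNormSq_nonneg _
  set D : ℝ≥0∞ := ∫⁻ τ in Ioo t T, ∫⁻ x, ENNReal.ofReal (frobeniusNormSq (fderiv ℝ (u τ) x)) with hD
  have hDfin : D ≠ ⊤ :=
    (CertifiedBlowupAxisymBlowup.EnergyDrain.dissipation_le_energy_sub hν hcl hLH ht.1.le
      ht.2.le le_rfl).1
  set R : ℝ := ν / 2 * η * D.toReal + ν / 2 * η⁻¹ * Z * (T - t) +
    Kc ^ (3 / 2 : ℝ) * I₀ ^ (1 / 4 : ℝ) * Real.sqrt Z * M ^ (3 / 4 : ℝ) *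
      ((T - t) ^ (1 - 3 * α / 4) / (1 - 3 * α / 4)) with hR
  have hincr : ∀ s ∈ Ioo t T, |(∫ x, ⟪u s x, u t x⟫) - ∫ x, ‖u t x‖ ^ 2| ≤ R := by
    intro s hs
    set S : ℝ := (s + T) / 2 with hSdef
    have hsS : s < S := by rw [hSdef]; linarith [hs.2]
    have hST : S < T := by rw [hSdef]; linarith [hs.2]
    have hS : 0 < S := (ht.1.trans hs.1).trans hsS
    have hsolS : IsClassicalNSSolutionOn (Icc 0 S) ν 0 u p :=
      hcl.mono (Icc_subset_Ico_right hST) (uniqueDiffOn_Icc hS)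
    have hE' : ∃ C' : ℝ≥0, ∀ τ ∈ Icc 0 S, ∫⁻ x, ‖u τ x‖ₑ ^ 2 ≤ C' :=
      ⟨(ENNReal.ofReal (2 * VectorCalculus.kineticEnergy (u 0))).toNNReal, fun τ hτ => by
        rw [ENNReal.coe_toNNReal ENNReal.ofReal_ne_top]
        exact hLH.lintegral_enorm_sq_le hν.le ⟨hτ.1, hτ.2.trans hST.le⟩⟩
    have hB : HasBoundedSobolevNormsOn (Icc 0 S) u :=
      tao2011_hasBoundedSobolevNormsOn_holds hν hS hsolS hE' hdec
    have hZ' : ∀ τ ∈ Ioo t s, ∫ x, frobeniusNormSq (fderiv ℝ (u τ) x) ≤ M * (T - τ) ^ (-α) :=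
      fun τ hτ => hZ τ ⟨hτ.1, hτ.2.trans hs.2⟩
    have h := sliceTestH1_increment_abs_le_slab hν hS hsolS hB
      (fun τ hτ => hI₀le τ ⟨hτ.1, hτ.2.trans hST.le⟩) ht.1 hs.1 hsS hs.2 hM hα0 hα hZ' hη
    rw [← hKc] at h
    have hmono : (∫⁻ τ in Ioo t s, ∫⁻ x, ENNReal.ofReal (frobeniusNormSq (fderiv ℝ (u τ) x))).toReal ≤
        D.toReal :=
      ENNReal.toReal_mono hDfin (lintegral_mono_set (Ioo_subset_Ioo_right hs.2.le))
    have h1 : ν / 2 * η *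
        (∫⁻ τ in Ioo t s, ∫⁻ x, ENNReal.ofReal (frobeniusNormSq (fderiv ℝ (u τ) x))).toReal ≤
        ν / 2 * η * D.toReal := mul_le_mul_of_nonneg_left hmono (by positivity)
    have h2 : ν / 2 * η⁻¹ * Z * (s - t) ≤ ν / 2 * η⁻¹ * Z * (T - t) :=
      mul_le_mul_of_nonneg_left (by linarith [hs.2]) (by positivity)
    rw [hR]
    linarith
  have hle_filter : 𝓝[<] T ≤ 𝓝[Ioc 0 T] T := by
    rw [← nhdsWithin_Ioo_eq_nhdsLT hT]
    exact nhdsWithin_mono _ Ioo_subset_Ioc_self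
  have hlim : Tendsto (fun s => (∫ x, ⟪u s x, u t x⟫) - ∫ x, ‖u t x‖ ^ 2) (𝓝[<] T)
      (𝓝 ((∫ x, ⟪u T x, u t x⟫) - ∫ x, ‖u t x‖ ^ 2)) :=
    ((((hLH.weak_continuous (u t) hmt).1) T ⟨hT, le_rfl⟩).tendsto.mono_left hle_filter).sub
      tendsto_const_nhds
  have hev : ∀ᶠ s in 𝓝[<] T, |(∫ x, ⟪u s x, u t x⟫) - ∫ x, ‖u t x‖ ^ 2| ≤ R := by
    filter_upwards [Ioo_mem_nhdsLT ht.2] with s hs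
    exact hincr s hs
  have hfinal := le_of_tendsto hlim.abs hev
  rw [hR] at hfinal
  exact hfinal

/-! ### THE ENSTROPHY-RATE TERMINAL APPROACH LAW -/

/-- **THE ENSTROPHY-RATE TERMINAL APPROACH LAW.** `(u,p)` classical on `[0,T)` (`ν, T > 0`),
Leray–Hopf on `[0,T]` from a rapidly decaying datum, `t ∈ (0,T)`, and the enstrophy rate
`∫|Du(τ)|²_F ≤ M (T−τ)^{−α}` on `(t,T)` (`M ≥ 0`, `0 < α < 4/3`). Then, with `Z = ∫|Du(t)|²_F`,
`E₀ = E(u 0)`, `β = 3α/4` and Mathlib's Sobolev constant `K`: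
`∫‖u(t) − u(T)‖² ≤ (ν/2)(T−t)Z + 2K^{3/2}(2E₀)^{1/4} M^{3/4} √Z (T−t)^{1−β}/(1−β)`.
As `typeI_terminalApproach_le` (p639359) with the `H¹` slice test: the transport term is bounded by
`‖Du(t)‖₂‖u(τ)‖₄²` and Ladyzhenskaya's inequality instead of the sup norm. [folklore] -/
theorem enstrophyRate_terminalApproach_le {ν T : ℝ} (hν : 0 < ν) (hT : 0 < T)
    {u : ℝ → EuclideanSpace ℝ (Fin 3) → EuclideanSpace ℝ (Fin 3)} {p : ℝ → EuclideanSpace ℝ (Fin 3) → ℝ}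
    (hcl : IsClassicalNSSolutionOn (Ico 0 T) ν 0 u p) (hLH : IsLerayHopfOn T ν 0 (u 0) u)
    (hdec : HasRapidSpatialDecay (u 0))
    {M α : ℝ} (hM : 0 ≤ M) (hα0 : 0 < α) (hα : α < 4 / 3) {t : ℝ} (ht : t ∈ Ioo 0 T)
    (hZ : ∀ τ ∈ Ioo t T, ∫ x, frobeniusNormSq (fderiv ℝ (u τ) x) ≤ M * (T - τ) ^ (-α)) :
    ∫ x, ‖u t x - u T x‖ ^ 2 ≤
      ν / 2 * ((T - t) * ∫ x, frobeniusNormSq (fderiv ℝ (u t) x)) +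
        2 * ((SNormLESNormFDerivOfEqConst (EuclideanSpace ℝ (Fin 3))
            (volume : Measure (EuclideanSpace ℝ (Fin 3))) 2 : ℝ) ^ (3 / 2 : ℝ) *
          (2 * VectorCalculus.kineticEnergy (u 0)) ^ (1 / 4 : ℝ) *
          Real.sqrt (∫ x, frobeniusNormSq (fderiv ℝ (u t) x)) *
          M ^ (3 / 4 : ℝ) * ((T - t) ^ (1 - 3 * α / 4) / (1 - 3 * α / 4))) := by
  set Z : ℝ := ∫ x, frobeniusNormSq (fderiv ℝ (u t) x) with hZdef
  obtain ⟨-, hDle⟩ := CertifiedBlowupAxisymBlowup.EnergyDrain.dissipation_le_energy_sub hν hcl hLH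
    ht.1.le ht.2.le le_rfl
  have h := sliceTestH1_terminal_abs_le hν hT hcl hLH hdec hM hα0 hα ht hZ (by norm_num : (0:ℝ) < 2)
  have hid := integral_norm_sub_sq_terminal_eq hT hLH ⟨ht.1.le, ht.2.le⟩
  have hcomm : ∫ x, ⟪u t x, u T x⟫ = ∫ x, ⟪u T x, u t x⟫ :=
    integral_congr_ae (Eventually.of_forall fun x => real_inner_comm _ _)
  have hEt : ∫ x, ‖u t x‖ ^ 2 = 2 * VectorCalculus.kineticEnergy (u t) := by
    simp only [VectorCalculus.kineticEnergy]; ring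
  have hET : ∫ x, ‖u T x‖ ^ 2 = 2 * VectorCalculus.kineticEnergy (u T) := by
    simp only [VectorCalculus.kineticEnergy]; ring
  obtain ⟨hlo, -⟩ := abs_le.1 h
  have e1 : ν / 2 * (2 : ℝ) = ν := by ring
  have e2 : ν / 2 * (2 : ℝ)⁻¹ * Z * (T - t) = ν / 4 * ((T - t) * Z) := by ring
  rw [e1, e2] at hlo
  rw [hid, hcomm, hEt, hET]
  linarith

/-! ### ENERGY EQUALITY AT A FIRST BLOW-UP WITH ENSTROPHY BELOW THE RATE `(T−t)^{−4/5}` -/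

/-- **AN ENSTROPHY RATE BELOW `(T−t)^{−4/5}` FORCES THE ENERGY EQUALITY AT `T`** (mildly Type-II
blow-ups do not jump). `(u,p)` classical on `[0,T)` (`ν, T > 0`), Leray–Hopf on `[0,T]` from a rapidly
decaying datum, and `∫|Du(t)|²_F ≤ M (T−t)^{−α}` for `t < T` near `T`, with `M ≥ 0` and `0 < α < 4/5`.
Then `∫‖u(t) − u(T)‖² → 0` as `t ↑ T` — indeed `= O((T−t)^{1−5α/4})` by the enstrophy-rate terminal
approach law. Leray's own rate is `α = 1/2` (the ENSTROPHY QUARTER LAW of this route, stmt-1574, is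
`α = 1/2` with a uniform constant), so every first blow-up with enstrophy at most `(T−t)^{−4/5+ε}`
— Type-II in enstrophy by less than `3/10` beyond Leray — is energy-continuous at `T`. In print this is
inside the `L³B^{1/3}_{3,∞}` energy-equality class (Cheskidov–Constantin–Friedlander–Shvydkoy 2008;
Cheskidov–Luo 2020 §2.2) via `‖u‖_{B^{1/3}_{3,∞}} ≲ ‖u‖₂^{1/6}‖∇u‖₂^{5/6}`; here by elementary slice
testing in the first-blow-up frame. Independent of the sup-norm Type-I theorem
`tendsto_integral_norm_sub_sq_of_isTypeIBlowup` (neither hypothesis implies the other). [folklore] -/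
theorem tendsto_integral_norm_sub_sq_of_enstrophyRate {ν T : ℝ} (hν : 0 < ν) (hT : 0 < T)
    {u : ℝ → EuclideanSpace ℝ (Fin 3) → EuclideanSpace ℝ (Fin 3)} {p : ℝ → EuclideanSpace ℝ (Fin 3) → ℝ}
    (hcl : IsClassicalNSSolutionOn (Ico 0 T) ν 0 u p) (hLH : IsLerayHopfOn T ν 0 (u 0) u)
    (hdec : HasRapidSpatialDecay (u 0))
    {M α : ℝ} (hM : 0 ≤ M) (hα0 : 0 < α) (hα : α < 4 / 5)
    (hrate : ∀ᶠ t in 𝓝[<] T, ∫ x, frobeniusNormSq (fderiv ℝ (u t) x) ≤ M * (T - t) ^ (-α)) :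
    Tendsto (fun t => ∫ x, ‖u t x - u T x‖ ^ 2) (𝓝[<] T) (𝓝 0) := by
  set Kc : ℝ := (SNormLESNormFDerivOfEqConst (EuclideanSpace ℝ (Fin 3))
    (volume : Measure (EuclideanSpace ℝ (Fin 3))) 2 : ℝ) with hKc
  have hKc0 : 0 ≤ Kc := NNReal.coe_nonneg _
  set E₀ : ℝ := VectorCalculus.kineticEnergy (u 0) with hE₀
  have hE₀0 : 0 ≤ E₀ := kineticEnergy_nonneg (u 0)
  set β : ℝ := 3 * α / 4 with hβ
  have hβ1 : 0 < 1 - β := by rw [hβ]; linarith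
  have hα43 : α < 4 / 3 := by linarith
  obtain ⟨a, haT, ha⟩ := mem_nhdsLT_iff_exists_Ioo_subset.1 hrate
  -- the two rate constants and exponents
  set C₁ : ℝ := ν / 2 * M with hC₁
  set C₂ : ℝ := 2 * (Kc ^ (3 / 2 : ℝ) * (2 * E₀) ^ (1 / 4 : ℝ) * Real.sqrt M * M ^ (3 / 4 : ℝ) /
    (1 - β)) with hC₂
  set γ₁ : ℝ := 1 - α with hγ₁
  set γ₂ : ℝ := 1 - β - α / 2 with hγ₂
  have hγ₁0 : 0 < γ₁ := by rw [hγ₁]; linarith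
  have hγ₂0 : 0 < γ₂ := by rw [hγ₂, hβ]; linarith
  -- the bound on `(max a 0, T)`
  have hbound : ∀ t ∈ Ioo (max a 0) T,
      ∫ x, ‖u t x - u T x‖ ^ 2 ≤ C₁ * (T - t) ^ γ₁ + C₂ * (T - t) ^ γ₂ := by
    intro t htI
    have ht : t ∈ Ioo 0 T := ⟨(le_max_right a 0).trans_lt htI.1, htI.2⟩
    have hx : 0 < T - t := sub_pos.2 ht.2
    have hZ' : ∀ τ ∈ Ioo t T, ∫ x, frobeniusNormSq (fderiv ℝ (u τ) x) ≤ M * (T - τ) ^ (-α) :=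
      fun τ hτ => ha ⟨(le_max_left a 0).trans_lt (htI.1.trans hτ.1), hτ.2⟩
    have happ := enstrophyRate_terminalApproach_le hν hT hcl hLH hdec hM hα0 hα43 ht hZ'
    rw [← hKc, ← hE₀] at happ
    set Z : ℝ := ∫ x, frobeniusNormSq (fderiv ℝ (u t) x) with hZdef
    have hZ0 : 0 ≤ Z := integral_nonneg fun x => frobeniusNormSq_nonneg _
    have hZt : Z ≤ M * (T - t) ^ (-α) := ha ⟨(le_max_left a 0).trans_lt htI.1, htI.2⟩
    -- first term
    have h1 : ν / 2 * ((T - t) * Z) ≤ C₁ * (T - t) ^ γ₁ := by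
      have e0 : (T - t) ^ γ₁ = (T - t) * (T - t) ^ (-α) := by
        rw [hγ₁, show (1 : ℝ) - α = 1 + -α by ring, Real.rpow_add hx, Real.rpow_one]
      have e : (T - t) * (M * (T - t) ^ (-α)) = M * (T - t) ^ γ₁ := by
        rw [e0]; ring
      calc ν / 2 * ((T - t) * Z) ≤ ν / 2 * ((T - t) * (M * (T - t) ^ (-α))) :=
            mul_le_mul_of_nonneg_left (mul_le_mul_of_nonneg_left hZt hx.le) (by positivity)
        _ = C₁ * (T - t) ^ γ₁ := by rw [e, hC₁]; ring
    -- second term: `√Z ≤ √M (T−t)^{−α/2}`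
    have hsqrt : Real.sqrt Z ≤ Real.sqrt M * (T - t) ^ (-(α / 2)) := by
      have h := Real.sqrt_le_sqrt hZt
      rw [Real.sqrt_mul hM, Real.sqrt_eq_rpow ((T - t) ^ (-α)), ← Real.rpow_mul hx.le] at h
      have e : -α * (1 / 2 : ℝ) = -(α / 2) := by ring
      rwa [e] at h
    have h2 : 2 * (Kc ^ (3 / 2 : ℝ) * (2 * E₀) ^ (1 / 4 : ℝ) * Real.sqrt Z * M ^ (3 / 4 : ℝ) *
        ((T - t) ^ (1 - 3 * α / 4) / (1 - 3 * α / 4))) ≤ C₂ * (T - t) ^ γ₂ := by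
      have hpre : 0 ≤ Kc ^ (3 / 2 : ℝ) * (2 * E₀) ^ (1 / 4 : ℝ) := by positivity
      have hpost : 0 ≤ M ^ (3 / 4 : ℝ) * ((T - t) ^ (1 - 3 * α / 4) / (1 - 3 * α / 4)) := by
        have : 0 ≤ (T - t) ^ (1 - 3 * α / 4) := Real.rpow_nonneg hx.le _
        rw [← hβ] at this ⊢
        positivity
      have h3 : Kc ^ (3 / 2 : ℝ) * (2 * E₀) ^ (1 / 4 : ℝ) * Real.sqrt Z * M ^ (3 / 4 : ℝ) *
          ((T - t) ^ (1 - 3 * α / 4) / (1 - 3 * α / 4)) ≤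
          Kc ^ (3 / 2 : ℝ) * (2 * E₀) ^ (1 / 4 : ℝ) * (Real.sqrt M * (T - t) ^ (-(α / 2))) *
            M ^ (3 / 4 : ℝ) * ((T - t) ^ (1 - 3 * α / 4) / (1 - 3 * α / 4)) := by
        have := mul_le_mul_of_nonneg_left hsqrt hpre
        calc _ = (Kc ^ (3 / 2 : ℝ) * (2 * E₀) ^ (1 / 4 : ℝ) * Real.sqrt Z) *
              (M ^ (3 / 4 : ℝ) * ((T - t) ^ (1 - 3 * α / 4) / (1 - 3 * α / 4))) := by ring
          _ ≤ (Kc ^ (3 / 2 : ℝ) * (2 * E₀) ^ (1 / 4 : ℝ) * (Real.sqrt M * (T - t) ^ (-(α / 2)))) *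
              (M ^ (3 / 4 : ℝ) * ((T - t) ^ (1 - 3 * α / 4) / (1 - 3 * α / 4))) :=
            mul_le_mul_of_nonneg_right this hpost
          _ = _ := by ring
      have e : (T - t) ^ (-(α / 2)) * (T - t) ^ (1 - 3 * α / 4) = (T - t) ^ γ₂ := by
        rw [← Real.rpow_add hx, hγ₂, hβ]; ring_nf
      calc _ ≤ 2 * (Kc ^ (3 / 2 : ℝ) * (2 * E₀) ^ (1 / 4 : ℝ) * (Real.sqrt M * (T - t) ^ (-(α / 2))) *
            M ^ (3 / 4 : ℝ) * ((T - t) ^ (1 - 3 * α / 4) / (1 - 3 * α / 4))) :=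
          mul_le_mul_of_nonneg_left h3 (by norm_num)
        _ = C₂ * ((T - t) ^ (-(α / 2)) * (T - t) ^ (1 - 3 * α / 4)) := by
          rw [hC₂, hβ]; ring
        _ = C₂ * (T - t) ^ γ₂ := by rw [e]
    linarith
  -- the bound tends to `0`
  have hsub : Tendsto (fun t : ℝ => T - t) (𝓝[<] T) (𝓝 0) := by
    have h : Tendsto (fun t : ℝ => T - t) (𝓝 T) (𝓝 (T - T)) := tendsto_const_nhds.sub tendsto_id
    rw [sub_self] at h
    exact tendsto_nhdsWithin_of_tendsto_nhds h
  have hpow : ∀ γ : ℝ, 0 < γ → Tendsto (fun t : ℝ => (T - t) ^ γ) (𝓝[<] T) (𝓝 0) := by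
    intro γ hγ
    have h := hsub.rpow_const (p := γ) (Or.inr hγ.le)
    rwa [Real.zero_rpow hγ.ne'] at h
  have hlim : Tendsto (fun t : ℝ => C₁ * (T - t) ^ γ₁ + C₂ * (T - t) ^ γ₂) (𝓝[<] T) (𝓝 0) := by
    have h := ((hpow γ₁ hγ₁0).const_mul C₁).add ((hpow γ₂ hγ₂0).const_mul C₂)
    simpa using h
  refine squeeze_zero' ?_ ?_ hlim
  · exact Eventually.of_forall fun t => integral_nonneg fun x => sq_nonneg _
  · filter_upwards [Ioo_mem_nhdsLT (max_lt haT hT)] with t ht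
    exact hbound t ht

/-- **Enstrophy rate below `(T−t)^{−4/5}` ⇒ no energy jump, `eLpNorm` form** (the conclusion shape of
stub `stub_typeIIEnergyEquality`). [folklore] -/
theorem tendsto_eLpNorm_sub_of_enstrophyRate {ν T : ℝ} (hν : 0 < ν) (hT : 0 < T)
    {u : ℝ → EuclideanSpace ℝ (Fin 3) → EuclideanSpace ℝ (Fin 3)} {p : ℝ → EuclideanSpace ℝ (Fin 3) → ℝ}
    (hcl : IsClassicalNSSolutionOn (Ico 0 T) ν 0 u p) (hLH : IsLerayHopfOn T ν 0 (u 0) u)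
    (hdec : HasRapidSpatialDecay (u 0))
    {M α : ℝ} (hM : 0 ≤ M) (hα0 : 0 < α) (hα : α < 4 / 5)
    (hrate : ∀ᶠ t in 𝓝[<] T, ∫ x, frobeniusNormSq (fderiv ℝ (u t) x) ≤ M * (T - t) ^ (-α)) :
    Tendsto (fun t => eLpNorm (u t - u T) 2 volume) (𝓝[<] T) (𝓝 0) :=
  (tendsto_eLpNorm_sub_iff_tendsto_integral_norm_sub_sq hT hLH).2
    (tendsto_integral_norm_sub_sq_of_enstrophyRate hν hT hcl hLH hdec hM hα0 hα hrate)

/-- **Enstrophy rate below `(T−t)^{−4/5}` ⇒ LERAY'S ENERGY EQUALITY on `[0,T]`**: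
`E(u T) + ν∫₀ᵀ∫|∇u|²_F = E(u 0)` (`tendsto_eLpNorm_sub_iff_energyEquality`, p632964). [folklore] -/
theorem energyEquality_of_enstrophyRate {ν T : ℝ} (hν : 0 < ν) (hT : 0 < T)
    {u : ℝ → EuclideanSpace ℝ (Fin 3) → EuclideanSpace ℝ (Fin 3)} {p : ℝ → EuclideanSpace ℝ (Fin 3) → ℝ}
    (hcl : IsClassicalNSSolutionOn (Ico 0 T) ν 0 u p) (hLH : IsLerayHopfOn T ν 0 (u 0) u)
    (hdec : HasRapidSpatialDecay (u 0))
    {M α : ℝ} (hM : 0 ≤ M) (hα0 : 0 < α) (hα : α < 4 / 5)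
    (hrate : ∀ᶠ t in 𝓝[<] T, ∫ x, frobeniusNormSq (fderiv ℝ (u t) x) ≤ M * (T - t) ^ (-α)) :
    VectorCalculus.kineticEnergy (u T) +
      ν * (∫⁻ τ in Ioo 0 T, ∫⁻ x, ENNReal.ofReal (frobeniusNormSq (fderiv ℝ (u τ) x))).toReal =
      VectorCalculus.kineticEnergy (u 0) :=
  (tendsto_eLpNorm_sub_iff_energyEquality hν hT hcl hLH).1
    (tendsto_eLpNorm_sub_of_enstrophyRate hν hT hcl hLH hdec hM hα0 hα hrate)

/-- **Enstrophy rate below `(T−t)^{−4/5}` ⇒ no fast energy concentration** (the conclusion of shelf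
statement stmt-18118 `HodographBetchov.NoFastEnergyConcentration` for THIS solution, via the landed
`FastClassSqueeze.Birth.stub_no_fast_energy_concentration_of_tendsto`). [folklore] -/
theorem noFastEnergyConcentration_of_enstrophyRate {ν T : ℝ} (hν : 0 < ν) (hT : 0 < T)
    {u : ℝ → EuclideanSpace ℝ (Fin 3) → EuclideanSpace ℝ (Fin 3)} {p : ℝ → EuclideanSpace ℝ (Fin 3) → ℝ}
    (hcl : IsClassicalNSSolutionOn (Ico 0 T) ν 0 u p) (hLH : IsLerayHopfOn T ν 0 (u 0) u)
    (hdec : HasRapidSpatialDecay (u 0))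
    {M α : ℝ} (hM : 0 ≤ M) (hα0 : 0 < α) (hα : α < 4 / 5)
    (hrate : ∀ᶠ t in 𝓝[<] T, ∫ x, frobeniusNormSq (fderiv ℝ (u t) x) ≤ M * (T - t) ^ (-α)) :
    ∀ ε : ℝ, 0 < ε → ∃ l : ℝ, 0 < l ∧ ∀ t ∈ Set.Ico 0 T,
      ∫⁻ x in {x : EuclideanSpace ℝ (Fin 3) | l < ‖u t x‖}, ‖u t x‖ₑ ^ 2 ≤ ENNReal.ofReal ε :=
  FastClassSqueeze.Birth.stub_no_fast_energy_concentration_of_tendsto ν T hν hT u p hcl hLH hdec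
    (tendsto_eLpNorm_sub_of_enstrophyRate hν hT hcl hLH hdec hM hα0 hα hrate)

/-! ### Position for the skeleton: stub 3 lives at ENSTROPHY-HEAVY non-Type-I first blow-ups -/

/-- **`TypeIIEnergyEquality ⟺ EnergyEqualityAtHeavyBlowup`.** The statement of stub
`stub_typeIIEnergyEquality` of `Cruxes/NoTerminalJolt/Lines/regular_split.lean` («a non-Type-I first
blow-up in the frame has no energy jump at `T`») is equivalent to the same statement restricted to
first blow-ups which are moreover ENSTROPHY-HEAVY: for NO `M ≥ 0`, `0 < α < 4/5` does
`∫|Du(t)|²_F ≤ M(T−t)^{−α}` hold near `T` (the mild case is the theorem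
`tendsto_eLpNorm_sub_of_enstrophyRate`). Both sides are OPEN statements; nothing is asserted about
them. [folklore] -/
theorem typeIIEnergyEquality_iff_enstrophyHeavy :
    (∀ (ν T : ℝ), 0 < ν → 0 < T →
      ∀ (u : ℝ → EuclideanSpace ℝ (Fin 3) → EuclideanSpace ℝ (Fin 3))
        (p : ℝ → EuclideanSpace ℝ (Fin 3) → ℝ),
        Literature.Analysis.FluidPDE.IsMaximalSmoothSolution ν 0 u p T →
        Literature.Analysis.FluidPDE.IsLerayHopfOn T ν 0 (u 0) u →
        Literature.Analysis.FluidPDE.HasRapidSpatialDecay (u 0) →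
        ¬ Literature.Analysis.FluidPDE.IsTypeIBlowup u T →
        Filter.Tendsto (fun t => MeasureTheory.eLpNorm (u t - u T) 2 MeasureTheory.volume)
          (nhdsWithin T (Set.Iio T)) (nhds 0)) ↔
    (∀ (ν T : ℝ), 0 < ν → 0 < T →
      ∀ (u : ℝ → EuclideanSpace ℝ (Fin 3) → EuclideanSpace ℝ (Fin 3))
        (p : ℝ → EuclideanSpace ℝ (Fin 3) → ℝ),
        Literature.Analysis.FluidPDE.IsMaximalSmoothSolution ν 0 u p T →
        Literature.Analysis.FluidPDE.IsLerayHopfOn T ν 0 (u 0) u →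
        Literature.Analysis.FluidPDE.HasRapidSpatialDecay (u 0) →
        ¬ Literature.Analysis.FluidPDE.IsTypeIBlowup u T →
        (∀ M α : ℝ, 0 ≤ M → 0 < α → α < 4 / 5 →
          ¬ ∀ᶠ t in nhdsWithin T (Set.Iio T),
            ∫ x, frobeniusNormSq (fderiv ℝ (u t) x) ≤ M * (T - t) ^ (-α)) →
        Filter.Tendsto (fun t => MeasureTheory.eLpNorm (u t - u T) 2 MeasureTheory.volume)
          (nhdsWithin T (Set.Iio T)) (nhds 0)) := by
  refine ⟨fun h ν T hν hT u p hmax hLH hdec hnI _ => h ν T hν hT u p hmax hLH hdec hnI,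
    fun h ν T hν hT u p hmax hLH hdec hnI => ?_⟩
  by_cases hmild : ∃ M α : ℝ, 0 ≤ M ∧ 0 < α ∧ α < 4 / 5 ∧
      ∀ᶠ t in nhdsWithin T (Set.Iio T), ∫ x, frobeniusNormSq (fderiv ℝ (u t) x) ≤ M * (T - t) ^ (-α)
  · obtain ⟨M, α, hM, hα0, hα, hrate⟩ := hmild
    exact tendsto_eLpNorm_sub_of_enstrophyRate hν hT hmax.1 hLH hdec hM hα0 hα hrate
  · exact h ν T hν hT u p hmax hLH hdec hnI fun M α hM hα0 hα hev =>
      hmild ⟨M, α, hM, hα0, hα, hev⟩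

end NoTerminalJolt

end Summit.NavierStokesRegularity.NavierStokesRegularity.Theorems

end
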